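import Literature.MathematicalPhysics.QuantumFieldTheory.Balaban1983to89.B9Eq342GreenPrimeTowerSupBoundDecayPenalty
import Literature.MathematicalPhysics.QuantumFieldTheory.Balaban1983to89.B9Eq349ConjugatedGreenBlockDecayTower
import Literature.MathematicalPhysics.QuantumFieldTheory.Balaban1983to89.B3Op116ScaleChains

/-!
# `Balaban1983to89.B9Eq342GreenPrimeTowerDecayRowClosed` — T. Bałaban, *Propagators for lattice gauge theories in a background field*, Commun. Math. Phys.
# **99** (1985) 389–434 [Balaban1985BackgroundPropagators] Thm 3.1 (3.42) p. 397, FIRST ENTRY WITH ITS DECAY FACTOR («δ₀, B₀ dependent on d and L only»), FOR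
# PRINT's `G′_k(U)` (`B9Eq324DeltaPrimeATower.GpOfUk`): **THE DECAYED VALUE ROW AT THE TOWER, CLOSED — `∃ α₁ C ρ κ′` BEFORE THE HEIGHT such that on print's
# diagonal window, for every source `f` supported in ONE big block `v` with `‖f‖_∞ ≤ F` and every fine site `x₀`:
# `‖(G′_k(U)f)(x₀)‖ ≤ B(d, a′, C, κ′)·e^{−κ′·d_m(Πx₀, v)}·F`** — this lineage's T-B `B9Eq342GreenPrimeTowerSupBoundDecayCosh.norm_GpOfUk_apply_le_decay_cosh`
# at the explicit rate, (D-P)k and the masses inhabited by ne9-leaf-03's `B9Eq324PenaltyBlockLocal`, (D-E)k by ne9-leaf-03 g74's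
# `B9Eq349ConjugatedGreenBlockDecayTower.exists_block_decay_GpOfUk` (T-D `B9Eq342GreenPrimeTowerSupBoundDecayClosed` stopped one line later, at the row sum)

statement-level skeleton of published theorems with citation tags; proofs where landed; nothing here is a claim about the Yang–Mills mass gap

CITATION HEADER (lean-in-tree rule).  Audit cell `pub-balaban`, sub-cell `t4`, BINDER row NE9; filed by the NE9 OWNER lineage `b2b-balaban-t4-ne9-p1` (gen 95).
SOURCE READ first-hand in the held text layer [Balaban1985BackgroundPropagators] (`paper:balaban1985-cmp99-background-propagators`): p. 397 Thm 3.1 *«There exist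
positive constants M₁, δ₀, α₀, B₀ dependent on d and L only …»*, (3.42) first member `|(G′(U)λ)(x)| ≤ B₀(L^jη)²e^{−δ₀d(y,y′)}|λ|` for `x ∈ Δ(y)`, `supp λ ⊂ Δ(y′)`;
p. 398 *«We will prove the above theorem by constructing a random walk representation»* — NOT reproduced: the cell's road is the Kato domination bootstrap of the
OWNER's plan v10 (`t4/b2b-balaban-t4-ne9-p1/g89/SUP-NORM-PROGRAMME.md`) with storey (D) (decay by the `cosh` weight); this file is [folklore] COMPOSITION BY NAME.
Nothing printed is a hypothesis; the `[cite: …]` tags are TEXT LOCATIONS.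

WHY THIS FILE (cell context).  The covariant-gradient row `B9Eq342GreenPrimeTowerGradientRow(Diagonal)` CONSUMES the decayed value row `‖u(x)‖ ≤ C_u·F·e^{−κd_m(Πx,v)}`
with `(C_u, κ)` free of the height; T-D closed only the undecayed `L^∞ → L^∞` form.  This file closes the decayed form, so that the gradient row's last displayed
analytic letter is inhabited on print's diagonal window.

WHAT IS PROVED (sorry-free; proof lane — no `def`; [folklore]).
* §1 **`norm_GpOfUk_apply_le_decay_heightFree`** — T-B §1 `norm_GpOfUk_apply_le_decay_cosh` at the rate `a⋆ = √(1∕(4d(L^{n+1})² + 1))` of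
  `B9Eq342GreenPrimeSupBoundDecayCosh.rate_explicit` (`λ ≥ ½`, `a⋆L^{n+1} ≥ 1∕√(4d+1)`, `a⋆(L^{n+1}−1) ≤ ½`): for `f` supported in the big block `v`,
  `‖(G′_k(U)f)(x₀)‖ ≤ ((1 + p₂C_E√μ)·2e^{1∕2}·Σ_{l<k}2^{l+1} + √(3^d∕c₁·2^k)·√(2e^{1∕2}K_d(1∕√(4d+1) − 2κ′))·C_E√μ)·e^{−κ′d_m(Πx₀,v)}·F`, letters (T), (D-P)k `p₂`,
  (D-E)k `(C_E, κ)`, masses `μ` displayed (T-B's `_rowSum_heightFree` bookkeeping, one line earlier).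
* §2 **`norm_GpOfUk_apply_le_decay_heightFree_penalty`** (`p₂ := |a′|∕√c₁`, `μ := c₁`: a field supported in one big block IS its block piece, `‖f‖ ≤ √c₁·F`
  by ne9-leaf-03's `norm_block_le_sqrt_mul_tower`; (T) for the level averages `hRlev` displayed), **`…_penalty_unitary`** ((T) for `U` inhabited on the class).
* §3 **`exists_decayRow_GpOfUk`** — `∃ α₁ C ρ κ′` BEFORE the height (`κ′ := min(ρ, 1∕(4√(4d+1)))`): on print's diagonal window (`α ≤ α₁`, geometric level
  profile `ε_j ≤ αr^j`, unitary `U`, `*`-trace) `‖(G′_k(U)f)(x₀)‖ ≤ B·e^{−κ′·d_m(Πx₀,v)}·F` — the `hudec` letter of the gradient row, inhabited.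
HONEST SCOPE.  Composition BY NAME; the constant is the crude closed form of T-B∕T-C at `k := d`; nothing of [B9] Thm 3.1∕3.3∕3.11 asserted, valued or discharged
beyond what the named files prove on the cell's MODEL.  NOT summit progress (cell pub-balaban: NE9 NOT PRINTED ∕ NOT PROVED; «NE9 ⇐ the named binders»; row
WALLED ON A MODEL (O-NE9-1; #5 UNRULED); spine PROVED 0∕9; rung (B)+1 on a finite T⁴ — NOT infinite volume, NOT mass gap, NOT BetaPertH, NOT Clay).  HONEST
DEPENDENCY (cell line): continuum YM on T⁴ ⇐ BetaPertH ∧ nine spine estimates (0/9 proved); BetaPertH ⇐ (D1) ∧ (D4) ∧ CAP+tail; G-an2-4 gates asym, D1 and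
NE2/3/4.  NEW file; nothing modified.  Net new unproved facts: 0.
-/

noncomputable section

open scoped InnerProductSpace ComplexConjugate BigOperators

namespace Literature.MathematicalPhysics.QuantumFieldTheory.Balaban1983to89.B9Eq342GreenPrimeTowerDecayRowClosed

open B4Sect5Torus (TSite tdist)
open B4Sect5Proof (latticeConst latticeConst_nonneg)
open B3Op116ScaleChains (latticeConst_antitone)
open B7Prop1Explicit (U1)
open B9SectCLatticeCarrier (Bond)
open B9Eq311L2Pairing (WL2)
open B11Eq103H1Complex (SiteL2K covLaplaceSiteK)
open B9Eq310HessianOperator (adTransportW)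
open B9Eq319QprimeTorus (fineP blockCoord)
open B9Eq315QTower (towerP UlevOf towerP_apply)
open B9Eq316TowerFlatIsOneStep (towerP_eq_fineP_pow siteCast)
open B9Eq324DeltaPrimeATower (laplacePrimeAk GpOfUk)
open B9Eq342GreenPrimeSupBound (norm_adTransportW_eq norm_adTransportW_inv_eq)
open B9Eq342GreenPrimeSupBoundDecayCosh (rate_explicit)
open B9Eq342GreenPrimeTowerSupBoundDecay (bigBlock_eq_iff)
open B9Eq342GreenPrimeTowerSupBoundDecayCosh (norm_GpOfUk_apply_le_decay_cosh)
open B9Eq324PenaltyBlockLocal (norm_laplacePrimeAk_sub_covLaplace_apply_le_block_diagonal norm_block_le_sqrt_mul_tower)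
open B9Eq349ConjugatedGreenBlockDecayTower (exists_block_decay_GpOfUk)

variable {d : ℕ} (L : ℕ) [NeZero L] (m : Fin d → ℕ) [∀ i, NeZero (m i)] (n : ℕ)
  {𝔸 : Type*} [NormedRing 𝔸] [NormedAlgebra ℂ 𝔸] [CompleteSpace 𝔸]
  {W : Type*} [NormedAddCommGroup W] [InnerProductSpace ℂ W] [FiniteDimensional ℂ W] (φ : W ≃ₗ[ℂ] 𝔸) {c₀ : ℝ} [Fact (0 < c₀)]
  (η : ℝ) (U : Bond d (towerP L m (n + 1)) → 𝔸ˣ) {c₁ : ℝ} [Fact (0 < c₁)] (a' : ℝ)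
  (hpos' : ∀ x : SiteL2K ℂ d (towerP L m (n + 1)) c₀ W, x ≠ 0 → 0 < RCLike.re ⟪x, laplacePrimeAk L m n φ η U a' (c₁ := c₁) x⟫_ℂ)

/-! ## §1 The decayed row at the explicit rate: height-free letters -/

/-- **THE DECAYED VALUE ROW OF (3.42) FOR `G′_k(U)` WITH HEIGHT-FREE CONSTANTS** (`1 ≤ d ≤ k`; the diagonal `η⁻¹ = L^{n+1}`, `c₀(L^{n+1})^d = c₁`; rates
`0 < κ′ ≤ κ`, `2κ′ < 1∕√(4d+1)`; (T), (D-P)k `p₂`, (D-E)k `(C_E, κ)`, the mass `μ` of `f` displayed): for `f` supported in the big block `v` with `‖f(x)‖ ≤ F`,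
`‖f‖ ≤ √μF`: `‖(G′_k(U)f)(x₀)‖ ≤ ((1 + p₂C_E√μ)·2e^{1∕2}·Σ_{l<k}2^{l+1} + √(3^d∕c₁·2^k)·√(2e^{1∕2}K_d(1∕√(4d+1) − 2κ′))·C_E√μ)·e^{−κ′d_m(Πx₀,v)}·F` — T-B §1 at the
rate `a⋆` of `rate_explicit`, with `e^{a⋆(L^{n+1}−1)} ≤ e^{1∕2}`, `λ^{−j} ≤ 2^j`, `K_d(a⋆L^{n+1} − 2κ′) ≤ K_d(1∕√(4d+1) − 2κ′)`.
[cite: Balaban1985BackgroundPropagators, Thm 3.1 (3.42) p.397, (3.49) p.399; Balaban1984PropagatorsI, p.36] -/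
theorem norm_GpOfUk_apply_le_decay_heightFree (hd : 1 ≤ d)
    (hR : ∀ b w, ‖adTransportW φ U b w‖ ≤ ‖w‖) (hS : ∀ b w, ‖adTransportW φ (fun b => (U b)⁻¹) b w‖ ≤ ‖w‖)
    {PS : TSite d m → SiteL2K ℂ d (towerP L m (n + 1)) c₀ W →L[ℂ] SiteL2K ℂ d (towerP L m (n + 1)) c₀ W}
    (hPS : ∀ (y : TSite d m) (g : SiteL2K ℂ d (towerP L m (n + 1)) c₀ W) (x : TSite d (towerP L m (n + 1))),
      WL2.equiv ℂ (fun _ : TSite d (towerP L m (n + 1)) => c₀) W (PS y g) x =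
        if blockCoord (L ^ (n + 1)) m (siteCast (towerP_eq_fineP_pow L m (n + 1)) x) = y then
          WL2.equiv ℂ (fun _ : TSite d (towerP L m (n + 1)) => c₀) W g x else 0)
    {p₂ CE κ κ' : ℝ} (hp₂ : 0 ≤ p₂) (hCE : 0 ≤ CE) (hκ' : 0 < κ') (hκ : κ' ≤ κ) (h2κ : 2 * κ' < Real.sqrt (1 / (4 * d + 1)))
    (hηN : η⁻¹ = (L : ℝ) ^ (n + 1)) (hdiag : c₀ * ((L : ℝ) ^ (n + 1)) ^ d = c₁) {k : ℕ} (hk : d ≤ k)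
    (hP : ∀ (v : SiteL2K ℂ d (towerP L m (n + 1)) c₀ W) (x : TSite d (towerP L m (n + 1))),
      ‖WL2.equiv ℂ _ W (laplacePrimeAk L m n φ η U a' (c₁ := c₁) v -
        covLaplaceSiteK ((η : ℂ))⁻¹ (adTransportW φ U) (adTransportW φ fun b => (U b)⁻¹) v) x‖ ≤
        p₂ * ‖PS (blockCoord (L ^ (n + 1)) m (siteCast (towerP_eq_fineP_pow L m (n + 1)) x)) v‖)
    {v : TSite d m}
    (hdec : ∀ y : TSite d m, ‖PS y ∘L LinearMap.toContinuousLinearMap (GpOfUk L m n φ η U a' hpos') ∘L PS v‖ ≤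
      CE * Real.exp (-(κ * tdist m v y)))
    (x₀ : TSite d (towerP L m (n + 1))) (f : SiteL2K ℂ d (towerP L m (n + 1)) c₀ W)
    (hfv : ∀ x, blockCoord (L ^ (n + 1)) m (siteCast (towerP_eq_fineP_pow L m (n + 1)) x) ≠ v → WL2.equiv ℂ _ W f x = 0)
    {F μ : ℝ} (hF : ∀ y, ‖WL2.equiv ℂ _ W f y‖ ≤ F) (hμ : ‖f‖ ≤ Real.sqrt μ * F) :
    ‖WL2.equiv ℂ _ W (GpOfUk L m n φ η U a' hpos' f) x₀‖ ≤
      ((1 + p₂ * CE * Real.sqrt μ) * (Real.exp (1 / 2) * 2) * (∑ l ∈ Finset.range k, (2 : ℝ) ^ (l + 1)) +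
        Real.sqrt (3 ^ d / c₁ * 2 ^ k) * Real.sqrt ((Real.exp (1 / 2) * 2) * latticeConst d (Real.sqrt (1 / (4 * d + 1)) - 2 * κ')) *
          CE * Real.sqrt μ) *
        Real.exp (-(κ' * tdist m (blockCoord (L ^ (n + 1)) m (siteCast (towerP_eq_fineP_pow L m (n + 1)) x₀)) v)) * F := by
  have hc₁ : 0 < c₁ := Fact.out
  have hL1 : (1 : ℝ) ≤ L := by exact_mod_cast Nat.one_le_iff_ne_zero.mpr (NeZero.ne L)
  set N : ℝ := (L : ℝ) ^ (n + 1)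
  have hN1 : 1 ≤ N := one_le_pow₀ hL1
  have hN0 : 0 < N := lt_of_lt_of_le one_pos hN1
  -- the explicit rate and its three letters (`m = 1`, `t = N`)
  obtain ⟨ha0, _, hlam2, hκN⟩ := rate_explicit (d := d) N 1 one_pos hN1
  set a : ℝ := Real.sqrt (1 / (4 * d * N ^ 2 + 1))
  have ha : 0 ≤ a := ha0.le
  have hlam' : 1 / 2 ≤ 1 - 2 * d * (η⁻¹) ^ 2 * (Real.cosh a - 1) := by rw [hηN]; simpa using hlam2
  have hlam : 0 < 1 - 2 * d * (η⁻¹) ^ 2 * (Real.cosh a - 1) := lt_of_lt_of_le (by norm_num) hlam'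
  have hκN' : Real.sqrt (1 / (4 * d + 1)) ≤ a * N := by simpa using hκN
  have hκ₁ : 2 * κ' < a * (L : ℝ) ^ (n + 1) := lt_of_lt_of_le h2κ hκN'
  have hq : (0 : ℝ) < 1 / (4 * d * N ^ 2 + 1) := by positivity
  have haN : a * N ≤ 1 / 2 := by
    have e : a * N = Real.sqrt (1 / (4 * d * N ^ 2 + 1) * N ^ 2) := by
      rw [Real.sqrt_mul hq.le, Real.sqrt_sq hN0.le]
    rw [e, show (1 / 2 : ℝ) = Real.sqrt ((1 / 2) ^ 2) by rw [Real.sqrt_sq (by norm_num)]]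
    refine Real.sqrt_le_sqrt ?_
    have hd' : (1 : ℝ) ≤ d := by exact_mod_cast hd
    rw [div_mul_eq_mul_div, one_mul, div_le_iff₀ (by positivity)]
    nlinarith [sq_nonneg N]
  have haN1 : a * (N - 1) ≤ 1 / 2 := by nlinarith
  -- the diagonal letters of the (D-FS) supplier
  have hη : 0 < η⁻¹ := by rw [hηN]; exact hN0
  have hdiag' : c₀ * (η⁻¹) ^ d = c₁ := by rw [hηN]; exact hdiag
  have hvol : ∀ ν, η⁻¹ ≤ (towerP L m (n + 1) ν : ℝ) := fun ν => by
    rw [hηN, towerP_apply]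
    push_cast
    have h1 : (1 : ℝ) ≤ (m ν : ℝ) := by exact_mod_cast Nat.one_le_iff_ne_zero.mpr (NeZero.ne (m ν))
    nlinarith
  -- the decayed row at the rate `a⋆`
  have h := norm_GpOfUk_apply_le_decay_cosh L m n φ η U a' hpos' (c₁ := c₁) hR hS hPS hp₂ hCE ha hlam hk hη hdiag' hvol hκ'.le hκ hκ₁ hP hdec
    x₀ f hfv hF hμ
  refine h.trans ?_
  -- bookkeeping: every height-dependent constant against its height-free majorant
  have hF0 : 0 ≤ F := (norm_nonneg _).trans (hF x₀)
  have hE0 : 0 ≤ Real.exp (-(κ' * tdist m (blockCoord (L ^ (n + 1)) m (siteCast (towerP_eq_fineP_pow L m (n + 1)) x₀)) v)) :=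
    (Real.exp_pos _).le
  set lam : ℝ := 1 - 2 * d * (η⁻¹) ^ 2 * (Real.cosh a - 1)
  have hpow : ∀ j : ℕ, (lam ^ j)⁻¹ ≤ (2 : ℝ) ^ j := fun j => by
    have h1 : ((1 / 2 : ℝ) ^ j) ≤ lam ^ j := pow_le_pow_left₀ (by norm_num) hlam' j
    calc (lam ^ j)⁻¹ ≤ ((1 / 2 : ℝ) ^ j)⁻¹ := inv_anti₀ (pow_pos (by norm_num) j) h1
      _ = 2 ^ j := by rw [one_div, inv_pow, inv_inv]
  have hM : Real.exp (a * (N - 1)) * 2 ≤ Real.exp (1 / 2) * 2 :=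
    mul_le_mul_of_nonneg_right (Real.exp_le_exp.2 haN1) zero_le_two
  have hM0 : 0 ≤ Real.exp (a * (N - 1)) * 2 := by positivity
  have hKa : latticeConst d (a * N - 2 * κ') ≤ latticeConst d (Real.sqrt (1 / (4 * d + 1)) - 2 * κ') :=
    latticeConst_antitone (by linarith) (by linarith)
  have hKa0 : 0 ≤ latticeConst d (a * N - 2 * κ') := latticeConst_nonneg d (by linarith)
  have hsum : ∑ l ∈ Finset.range k, (lam ^ (l + 1))⁻¹ ≤ ∑ l ∈ Finset.range k, (2 : ℝ) ^ (l + 1) :=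
    Finset.sum_le_sum fun l _ => hpow (l + 1)
  have hsum0 : 0 ≤ ∑ l ∈ Finset.range k, (lam ^ (l + 1))⁻¹ := Finset.sum_nonneg fun l _ => inv_nonneg.2 (pow_nonneg hlam.le _)
  have hB₁ : (1 + p₂ * CE * Real.sqrt μ) * (Real.exp (a * (N - 1)) * 2) * (∑ l ∈ Finset.range k, (lam ^ (l + 1))⁻¹) ≤
      (1 + p₂ * CE * Real.sqrt μ) * (Real.exp (1 / 2) * 2) * (∑ l ∈ Finset.range k, (2 : ℝ) ^ (l + 1)) := by
    have h0 : 0 ≤ 1 + p₂ * CE * Real.sqrt μ := by positivity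
    exact mul_le_mul (mul_le_mul_of_nonneg_left hM h0) hsum hsum0 (mul_nonneg h0 (by positivity))
  have hC₃ : Real.sqrt (3 ^ d / c₁ * (lam ^ k)⁻¹) ≤ Real.sqrt (3 ^ d / c₁ * 2 ^ k) :=
    Real.sqrt_le_sqrt (mul_le_mul_of_nonneg_left (hpow k) (by positivity))
  have hMK : Real.sqrt ((Real.exp (a * (N - 1)) * 2) * latticeConst d (a * N - 2 * κ')) ≤
      Real.sqrt ((Real.exp (1 / 2) * 2) * latticeConst d (Real.sqrt (1 / (4 * d + 1)) - 2 * κ')) :=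
    Real.sqrt_le_sqrt (mul_le_mul hM hKa hKa0 (by positivity))
  have hB₂ : Real.sqrt (3 ^ d / c₁ * (lam ^ k)⁻¹) * Real.sqrt ((Real.exp (a * (N - 1)) * 2) * latticeConst d (a * N - 2 * κ')) * CE *
        Real.sqrt μ ≤
      Real.sqrt (3 ^ d / c₁ * 2 ^ k) * Real.sqrt ((Real.exp (1 / 2) * 2) * latticeConst d (Real.sqrt (1 / (4 * d + 1)) - 2 * κ')) * CE *
        Real.sqrt μ := by
    gcongr
  have hB := add_le_add hB₁ hB₂
  exact mul_le_mul_of_nonneg_right (mul_le_mul_of_nonneg_right hB hE0) hF0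

/-! ## §2 The (D-P)k letter and the mass inhabited: `p₂ = |a′|∕√c₁`, `μ = c₁` -/

/-- **THE DECAYED ROW WITH (D-P)k AND THE MASS INHABITED**: for `f` supported in the big block `v` with `‖f(x)‖ ≤ F`,
`‖(G′_k(U)f)(x₀)‖ ≤ ((1 + |a′|C_E)·2e^{1∕2}·Σ_{l<k}2^{l+1} + √(3^d·2^k)·√(2e^{1∕2}K_d(1∕√(4d+1) − 2κ′))·C_E)·e^{−κ′d_m(Πx₀,v)}·F` — §1 with `p₂ := |a′|∕√c₁`
(ne9-leaf-03's `norm_laplacePrimeAk_sub_covLaplace_apply_le_block_diagonal`, the level transporters' contraction `hRlev` displayed) and `μ := c₁` (the field IS its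
block piece: `‖f‖ = ‖P_vf‖ ≤ √(c₀L^{(n+1)d})F = √c₁F` by `norm_block_le_sqrt_mul_tower`), the weights cancelled — a constant in `(d, a′, C_E, κ′, k)` ALONE.
[cite: Balaban1985BackgroundPropagators, Thm 3.1 (3.42) p.397, (3.24) p.394, (3.19) p.393, (3.49) p.399] -/
theorem norm_GpOfUk_apply_le_decay_heightFree_penalty (hd : 1 ≤ d)
    (hR : ∀ b w, ‖adTransportW φ U b w‖ ≤ ‖w‖) (hS : ∀ b w, ‖adTransportW φ (fun b => (U b)⁻¹) b w‖ ≤ ‖w‖)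
    (hRlev : ∀ j b w, ‖adTransportW φ (UlevOf L m (n + 1) U j) b w‖ ≤ ‖w‖)
    {PS : TSite d m → SiteL2K ℂ d (towerP L m (n + 1)) c₀ W →L[ℂ] SiteL2K ℂ d (towerP L m (n + 1)) c₀ W}
    (hPS : ∀ (y : TSite d m) (g : SiteL2K ℂ d (towerP L m (n + 1)) c₀ W) (x : TSite d (towerP L m (n + 1))),
      WL2.equiv ℂ (fun _ : TSite d (towerP L m (n + 1)) => c₀) W (PS y g) x =
        if blockCoord (L ^ (n + 1)) m (siteCast (towerP_eq_fineP_pow L m (n + 1)) x) = y then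
          WL2.equiv ℂ (fun _ : TSite d (towerP L m (n + 1)) => c₀) W g x else 0)
    {CE κ κ' : ℝ} (hCE : 0 ≤ CE) (hκ' : 0 < κ') (hκ : κ' ≤ κ) (h2κ : 2 * κ' < Real.sqrt (1 / (4 * d + 1)))
    (hηN : η⁻¹ = (L : ℝ) ^ (n + 1)) (hdiag : c₀ * ((L : ℝ) ^ (n + 1)) ^ d = c₁) {k : ℕ} (hk : d ≤ k) {v : TSite d m}
    (hdec : ∀ y : TSite d m, ‖PS y ∘L LinearMap.toContinuousLinearMap (GpOfUk L m n φ η U a' hpos') ∘L PS v‖ ≤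
      CE * Real.exp (-(κ * tdist m v y)))
    (x₀ : TSite d (towerP L m (n + 1))) (f : SiteL2K ℂ d (towerP L m (n + 1)) c₀ W)
    (hfv : ∀ x, blockCoord (L ^ (n + 1)) m (siteCast (towerP_eq_fineP_pow L m (n + 1)) x) ≠ v → WL2.equiv ℂ _ W f x = 0)
    {F : ℝ} (hF : ∀ y, ‖WL2.equiv ℂ _ W f y‖ ≤ F) :
    ‖WL2.equiv ℂ _ W (GpOfUk L m n φ η U a' hpos' f) x₀‖ ≤
      ((1 + |a'| * CE) * (Real.exp (1 / 2) * 2) * (∑ l ∈ Finset.range k, (2 : ℝ) ^ (l + 1)) +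
        Real.sqrt (3 ^ d * 2 ^ k) * Real.sqrt ((Real.exp (1 / 2) * 2) * latticeConst d (Real.sqrt (1 / (4 * d + 1)) - 2 * κ')) * CE) *
        Real.exp (-(κ' * tdist m (blockCoord (L ^ (n + 1)) m (siteCast (towerP_eq_fineP_pow L m (n + 1)) x₀)) v)) * F := by
  have hc₁ : 0 < c₁ := Fact.out
  have hF0 : 0 ≤ F := (norm_nonneg _).trans (hF x₀)
  have hPS' : ∀ (y : TSite d m) (g : SiteL2K ℂ d (towerP L m (n + 1)) c₀ W) (x : TSite d (towerP L m (n + 1))),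
      WL2.equiv ℂ (fun _ : TSite d (towerP L m (n + 1)) => c₀) W (PS y g) x =
        if (∀ i, (x i : ℕ) / L ^ (n + 1) = (y i : ℕ)) then WL2.equiv ℂ (fun _ : TSite d (towerP L m (n + 1)) => c₀) W g x else 0 :=
    fun y g x => by rw [hPS]; exact if_congr (bigBlock_eq_iff L m n x y) rfl rfl
  -- (D-P)k with `p₂ = |a′|∕√c₁`
  have hP : ∀ (w : SiteL2K ℂ d (towerP L m (n + 1)) c₀ W) (x : TSite d (towerP L m (n + 1))),
      ‖WL2.equiv ℂ _ W (laplacePrimeAk L m n φ η U a' (c₁ := c₁) w -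
        covLaplaceSiteK ((η : ℂ))⁻¹ (adTransportW φ U) (adTransportW φ fun b => (U b)⁻¹) w) x‖ ≤
        |a'| * (Real.sqrt c₁)⁻¹ * ‖PS (blockCoord (L ^ (n + 1)) m (siteCast (towerP_eq_fineP_pow L m (n + 1)) x)) w‖ := fun w x =>
    norm_laplacePrimeAk_sub_covLaplace_apply_le_block_diagonal L m n φ U (hP := hPS') (hRlev := hRlev) hdiag η a' w x _
      ((bigBlock_eq_iff L m n x _).1 rfl)
  -- the mass `μ = c₁`: a field supported in the big block `v` is its own block piece
  have hfeq : PS v f = f := by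
    apply (WL2.equiv ℂ (fun _ : TSite d (towerP L m (n + 1)) => c₀) W).injective
    funext x
    rw [hPS]
    by_cases hx : blockCoord (L ^ (n + 1)) m (siteCast (towerP_eq_fineP_pow L m (n + 1)) x) = v
    · rw [if_pos hx]
    · rw [if_neg hx, hfv x hx]
  have hμ : ‖f‖ ≤ Real.sqrt c₁ * F := by
    have h := norm_block_le_sqrt_mul_tower L m n hPS' v f hF0 (fun x _ => hF x)
    rwa [hdiag, hfeq] at h
  have h := norm_GpOfUk_apply_le_decay_heightFree L m n φ η U a' hpos' (c₁ := c₁) hd hR hS hPS (by positivity) hCE hκ' hκ h2κ hηN hdiag hk hP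
    hdec x₀ f hfv hF hμ
  have hs : Real.sqrt c₁ ≠ 0 := (Real.sqrt_pos.2 hc₁).ne'
  have e1 : |a'| * (Real.sqrt c₁)⁻¹ * CE * Real.sqrt c₁ = |a'| * CE := by field_simp
  have e2 : Real.sqrt (3 ^ d / c₁ * 2 ^ k) * Real.sqrt ((Real.exp (1 / 2) * 2) * latticeConst d (Real.sqrt (1 / (4 * d + 1)) - 2 * κ')) *
      CE * Real.sqrt c₁ =
      Real.sqrt (3 ^ d * 2 ^ k) * Real.sqrt ((Real.exp (1 / 2) * 2) * latticeConst d (Real.sqrt (1 / (4 * d + 1)) - 2 * κ')) * CE := by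
    have e3 : Real.sqrt (3 ^ d / c₁ * 2 ^ k) * Real.sqrt c₁ = Real.sqrt (3 ^ d * 2 ^ k) := by
      rw [← Real.sqrt_mul (by positivity)]
      congr 1
      field_simp
    calc _ = (Real.sqrt (3 ^ d / c₁ * 2 ^ k) * Real.sqrt c₁) *
          Real.sqrt ((Real.exp (1 / 2) * 2) * latticeConst d (Real.sqrt (1 / (4 * d + 1)) - 2 * κ')) * CE := by ring
      _ = _ := by rw [e3]
  rw [e1, e2] at h
  exact h

/-- **… ON THE CHAIN's CLASS, (T) FOR `U` INHABITED** (`[StarRing 𝔸]`; unitary `U`, `*`-trace, compatible fibre norm); `hRlev` and (D-E)k stay displayed.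
[cite: Balaban1985BackgroundPropagators, Thm 3.1 (3.42) p.397] -/
theorem norm_GpOfUk_apply_le_decay_heightFree_penalty_unitary [StarRing 𝔸] (hd : 1 ≤ d) (τ : 𝔸 →ₗ[ℂ] ℂ)
    (hτ₂ : ∀ X Y : 𝔸, τ (X * Y) = τ (Y * X)) (hU : ∀ b, star (U b : 𝔸) = ((U b)⁻¹ : 𝔸ˣ))
    (hφ : ∀ X Y : 𝔸, ⟪φ.symm X, φ.symm Y⟫_ℂ = τ (star X * Y))
    (hRlev : ∀ j b w, ‖adTransportW φ (UlevOf L m (n + 1) U j) b w‖ ≤ ‖w‖)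
    {PS : TSite d m → SiteL2K ℂ d (towerP L m (n + 1)) c₀ W →L[ℂ] SiteL2K ℂ d (towerP L m (n + 1)) c₀ W}
    (hPS : ∀ (y : TSite d m) (g : SiteL2K ℂ d (towerP L m (n + 1)) c₀ W) (x : TSite d (towerP L m (n + 1))),
      WL2.equiv ℂ (fun _ : TSite d (towerP L m (n + 1)) => c₀) W (PS y g) x =
        if blockCoord (L ^ (n + 1)) m (siteCast (towerP_eq_fineP_pow L m (n + 1)) x) = y then
          WL2.equiv ℂ (fun _ : TSite d (towerP L m (n + 1)) => c₀) W g x else 0)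
    {CE κ κ' : ℝ} (hCE : 0 ≤ CE) (hκ' : 0 < κ') (hκ : κ' ≤ κ) (h2κ : 2 * κ' < Real.sqrt (1 / (4 * d + 1)))
    (hηN : η⁻¹ = (L : ℝ) ^ (n + 1)) (hdiag : c₀ * ((L : ℝ) ^ (n + 1)) ^ d = c₁) {k : ℕ} (hk : d ≤ k) {v : TSite d m}
    (hdec : ∀ y : TSite d m, ‖PS y ∘L LinearMap.toContinuousLinearMap (GpOfUk L m n φ η U a' hpos') ∘L PS v‖ ≤
      CE * Real.exp (-(κ * tdist m v y)))
    (x₀ : TSite d (towerP L m (n + 1))) (f : SiteL2K ℂ d (towerP L m (n + 1)) c₀ W)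
    (hfv : ∀ x, blockCoord (L ^ (n + 1)) m (siteCast (towerP_eq_fineP_pow L m (n + 1)) x) ≠ v → WL2.equiv ℂ _ W f x = 0)
    {F : ℝ} (hF : ∀ y, ‖WL2.equiv ℂ _ W f y‖ ≤ F) :
    ‖WL2.equiv ℂ _ W (GpOfUk L m n φ η U a' hpos' f) x₀‖ ≤
      ((1 + |a'| * CE) * (Real.exp (1 / 2) * 2) * (∑ l ∈ Finset.range k, (2 : ℝ) ^ (l + 1)) +
        Real.sqrt (3 ^ d * 2 ^ k) * Real.sqrt ((Real.exp (1 / 2) * 2) * latticeConst d (Real.sqrt (1 / (4 * d + 1)) - 2 * κ')) * CE) *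
        Real.exp (-(κ' * tdist m (blockCoord (L ^ (n + 1)) m (siteCast (towerP_eq_fineP_pow L m (n + 1)) x₀)) v)) * F :=
  norm_GpOfUk_apply_le_decay_heightFree_penalty L m n φ η U a' hpos' hd (fun b w => (norm_adTransportW_eq φ U τ hτ₂ hU hφ b w).le)
    (fun b w => (norm_adTransportW_inv_eq φ U τ hτ₂ hU hφ b w).le) hRlev hPS hCE hκ' hκ h2κ hηN hdiag hk hdec x₀ f hfv hF


/-! ## §3 (D-E)k inhabited: `∃ α₁ C ρ κ′` before the height -/

section Closed

variable {d : ℕ} (L : ℕ) [NeZero L] {𝔸 : Type*} [NormedRing 𝔸] [NormedAlgebra ℂ 𝔸] [CompleteSpace 𝔸] [NormOneClass 𝔸] [StarRing 𝔸]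
  {W : Type*} [NormedAddCommGroup W] [InnerProductSpace ℂ W] [FiniteDimensional ℂ W] (φ : W ≃ₗ[ℂ] 𝔸) {a' Mφ Mφ' : ℝ}
  (hMφ : 0 ≤ Mφ) (hMφ' : 0 ≤ Mφ') (hφn : ∀ w, ‖φ w‖ ≤ Mφ * ‖w‖) (hφn' : ∀ X, ‖φ.symm X‖ ≤ Mφ' * ‖X‖) (ha' : 0 < a')
  {r : ℝ} (hr0 : 0 ≤ r) (hr1 : r < 1)
  (τ : 𝔸 →ₗ[ℂ] ℂ) (hτ₂ : ∀ X Y : 𝔸, τ (X * Y) = τ (Y * X)) (hφτ : ∀ X Y : 𝔸, ⟪φ.symm X, φ.symm Y⟫_ℂ = τ (star X * Y))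

include hMφ hMφ' hφn hφn' ha' hr0 hr1 hτ₂ hφτ in
/-- **THE DECAYED VALUE ROW OF `G′_k(U)` CLOSED AT THE TOWER: `∃ α₁ C ρ κ′` BEFORE THE HEIGHT** (`1 ≤ d`; `L`, `M_φM_φ′`, `a′ > 0`, the profile ratio `r ∈ [0,1[`,
a `*`-trace compatible with the fibre norm given): at every height `n`, on print's diagonal `ηL^{n+1} = 1`, `c₀(L^{n+1})^d = c₁`, every period `m`, every background
with `hRS`, `U(b) ∈ U1`, `star U(b) = U(b)⁻¹`, `‖U(b) − 1‖ ≤ αη` (`α ≤ α₁`), level averages `‖Ū^j(b) − 1‖ ≤ ε_j ≤ αr^j` in `U1` with contractive transporters, ANY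
`hpos′`, every big-block family `P`, every big block `v`, every `f` supported in `Π⁻¹(v)` with `‖f(x)‖ ≤ F` and every `x₀`:
`‖(G′_k(U)f)(x₀)‖ ≤ B(d, a′, C, κ′)·e^{−κ′·d_m(Πx₀, v)}·F` — §2's unitary form at `k := d` with (D-E)k := ne9-leaf-03 g74's `exists_block_decay_GpOfUk` (`C_E := C`,
`κ := ρ`) and `κ′ := min(ρ, √(1∕(4d+1))∕4)`; the `hudec` letter of `B9Eq342GreenPrimeTowerGradientRow(Diagonal)`, inhabited.
[cite: Balaban1985BackgroundPropagators, Thm 3.1 (3.42) p.397, (3.35)–(3.37) p.396, (3.24)–(3.25) p.394, (3.49) p.399] -/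
theorem exists_decayRow_GpOfUk (hd : 1 ≤ d) :
    ∃ α₁ C ρ κ' : ℝ, 0 < α₁ ∧ 0 ≤ C ∧ 0 < ρ ∧ 0 < κ' ∧ κ' ≤ ρ ∧ 2 * κ' < Real.sqrt (1 / (4 * d + 1)) ∧
      ∀ (n : ℕ) (η : ℝ), η * (L : ℝ) ^ (n + 1) = 1 →
      ∀ (c₀ c₁ : ℝ) [Fact (0 < c₀)] [Fact (0 < c₁)], c₀ * ((L : ℝ) ^ (n + 1)) ^ d = c₁ →
      ∀ (m : Fin d → ℕ) [∀ i, NeZero (m i)] (U : Bond d (towerP L m (n + 1)) → 𝔸ˣ),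
        (∀ (b : Bond d (towerP L m (n + 1))) (v u : W), ⟪adTransportW φ U b v, u⟫_ℂ = ⟪v, adTransportW φ (fun b => (U b)⁻¹) b u⟫_ℂ) →
      ∀ (α : ℝ), 0 ≤ α → α ≤ α₁ → (∀ b, U b ∈ U1 𝔸) → (∀ b, ‖(U b : 𝔸) - 1‖ ≤ α * η) →
      ∀ (εU : ℕ → ℝ), (∀ j, 0 ≤ εU j) → (∀ j < n + 1, εU j ≤ α * r ^ j) →
        (∀ (j : ℕ) (b : Bond d (towerP L m (j + 1))), ‖(UlevOf L m (n + 1) U j b : 𝔸) - 1‖ ≤ εU j) →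
        (∀ (j : ℕ) (b : Bond d (towerP L m (j + 1))), UlevOf L m (n + 1) U j b ∈ U1 𝔸) →
        (∀ b, star (U b : 𝔸) = ((U b)⁻¹ : 𝔸ˣ)) →
        (∀ (j : ℕ) (b : Bond d (towerP L m (j + 1))) (w : W), ‖adTransportW φ (UlevOf L m (n + 1) U j) b w‖ ≤ ‖w‖) →
      ∀ (hpos' : ∀ x : SiteL2K ℂ d (towerP L m (n + 1)) c₀ W, x ≠ 0 → 0 < RCLike.re ⟪x, laplacePrimeAk L m n φ η U a' (c₁ := c₁) x⟫_ℂ)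
        (PS : TSite d m → SiteL2K ℂ d (towerP L m (n + 1)) c₀ W →L[ℂ] SiteL2K ℂ d (towerP L m (n + 1)) c₀ W),
        (∀ (y : TSite d m) (f : SiteL2K ℂ d (towerP L m (n + 1)) c₀ W) (x : TSite d (towerP L m (n + 1))),
          WL2.equiv ℂ (fun _ : TSite d (towerP L m (n + 1)) => c₀) W (PS y f) x =
            if blockCoord (L ^ (n + 1)) m (siteCast (towerP_eq_fineP_pow L m (n + 1)) x) = y then
              WL2.equiv ℂ (fun _ : TSite d (towerP L m (n + 1)) => c₀) W f x else 0) →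
      ∀ (v : TSite d m) (x₀ : TSite d (towerP L m (n + 1))) (f : SiteL2K ℂ d (towerP L m (n + 1)) c₀ W) (F : ℝ),
        (∀ x, blockCoord (L ^ (n + 1)) m (siteCast (towerP_eq_fineP_pow L m (n + 1)) x) ≠ v →
          WL2.equiv ℂ (fun _ : TSite d (towerP L m (n + 1)) => c₀) W f x = 0) →
        (∀ y, ‖WL2.equiv ℂ (fun _ : TSite d (towerP L m (n + 1)) => c₀) W f y‖ ≤ F) →
        ‖WL2.equiv ℂ (fun _ : TSite d (towerP L m (n + 1)) => c₀) W (GpOfUk L m n φ η U a' (c₁ := c₁) hpos' f) x₀‖ ≤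
          ((1 + |a'| * C) * (Real.exp (1 / 2) * 2) * (∑ l ∈ Finset.range d, (2 : ℝ) ^ (l + 1)) +
            Real.sqrt (3 ^ d * 2 ^ d) * Real.sqrt ((Real.exp (1 / 2) * 2) * latticeConst d (Real.sqrt (1 / (4 * d + 1)) - 2 * κ')) * C) *
          Real.exp (-(κ' * tdist m (blockCoord (L ^ (n + 1)) m (siteCast (towerP_eq_fineP_pow L m (n + 1)) x₀)) v)) * F := by
  obtain ⟨α₁, C, ρ, hα₁, hC, hρ, hdecAll⟩ := exists_block_decay_GpOfUk L φ (a' := a') hMφ hMφ' hφn hφn' ha' hr0 hr1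
  have hs0 : 0 < Real.sqrt (1 / (4 * (d : ℝ) + 1)) := Real.sqrt_pos.2 (by positivity)
  have hκ'0 : 0 < min ρ (Real.sqrt (1 / (4 * d + 1)) / 4) := lt_min hρ (by positivity)
  have hκ'ρ : min ρ (Real.sqrt (1 / (4 * d + 1)) / 4) ≤ ρ := min_le_left _ _
  have h2κ : 2 * min ρ (Real.sqrt (1 / (4 * d + 1)) / 4) < Real.sqrt (1 / (4 * d + 1)) := by
    have h1 : min ρ (Real.sqrt (1 / (4 * d + 1)) / 4) ≤ Real.sqrt (1 / (4 * d + 1)) / 4 := min_le_right _ _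
    linarith
  refine ⟨α₁, C, ρ, min ρ (Real.sqrt (1 / (4 * d + 1)) / 4), hα₁, hC, hρ, hκ'0, hκ'ρ, h2κ, ?_⟩
  intro n η hηL c₀ c₁ _ _ hdiag m _ U hRS α hα hαle hUb hUε εU hεU hεg hLε hLb hUstar hRlev hpos' PS hPS v x₀ f F hfv hF
  have hm : ∀ i, 1 ≤ m i := fun i => Nat.one_le_iff_ne_zero.mpr (NeZero.ne (m i))
  have hηN : η⁻¹ = (L : ℝ) ^ (n + 1) := inv_eq_of_mul_eq_one_right hηL
  have hdec : ∀ y : TSite d m, ‖PS y ∘L LinearMap.toContinuousLinearMap (GpOfUk L m n φ η U a' (c₁ := c₁) hpos') ∘L PS v‖ ≤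
      C * Real.exp (-(ρ * tdist m v y)) := fun y =>
    hdecAll n η hηL c₀ c₁ hdiag m hm U hRS α hα hαle hUb hUε εU hεU hεg hLε hLb hpos' PS hPS v y
  exact norm_GpOfUk_apply_le_decay_heightFree_penalty_unitary L m n φ η U a' hpos' (c₁ := c₁) hd τ hτ₂ hUstar hφτ hRlev hPS hC hκ'0 hκ'ρ h2κ
    hηN hdiag (le_refl d) hdec x₀ f hfv hF

end Closed

end Literature.MathematicalPhysics.QuantumFieldTheory.Balaban1983to89.B9Eq342GreenPrimeTowerDecayRowClosed

end
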